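import Mathlib
import Literature.MathematicalPhysics.QuantumLattice.HubbardBandSectorCountingToolbox
import Summits.HubbardSuperconductivity.HubbardSuperconductivity.Theorems.KLProgrammeKLRegimeTwoPointLimitShellTransversality
import Summits.HubbardSuperconductivity.HubbardSuperconductivity.Theorems.KLProgrammeKLRegimeTwoPointLimitShellMeasure1D
import Summits.HubbardSuperconductivity.HubbardSuperconductivity.Theorems.KLProgrammeKLRegimeTwoPointLimitShellSecondOrder
import Summits.HubbardSuperconductivity.HubbardSuperconductivity.Theorems.KLProgrammeKLRegimeTwoPointLimitShellCountCaustic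
import HarnessLib

/-!
# Route `KLProgramme` — crux K3 `KLRegimeTwoPointLimit` (stmt-HubbardSuperconductivity-19937), support:
# local descent and the caustic-window measure bound (DECOMP App. E Lemma E.3, assembly tools)

Cell `gate-hubbard-kl`, seat p1b; paper note `HOME/prover-p1b/E1-NOTE.md` §3 (assembly, caustic regime).
Near the `2k_F` caustic the slope of `G_w(θ) = ε(p_μ(θ) - w) - μ` degenerates on short windows, so the
global shell-measure lemma does not apply on a whole period. Two tools close the gap:

* `klsg_exists_zero_near` — **local descent**: if `|g z| ≤ δ` and `|g'| ≥ Λ` on the part of the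
  `δ/Λ`-ball around `z` where `|g| ≤ δ`, then `g` vanishes within `δ/Λ` of `z` (so GOOD points of the
  sublevel set are covered by `δ/Λ`-balls around zeros, wherever the windows are);
* `klsg_nearTangent_near_caustic` — a near-tangent point (`|G_w| ≤ η`, half-slope `≤ λ`) of a transfer
  away from the Cooper point has `2p_μ` within `ρ₁(η, λ)` of a caustic translate `w - 2πm`;
* `klsg_window_volume_le` — **the square-root cap on a caustic window**: the points of the sublevel set
  `{|G_w| ≤ δ}` of a period whose `2p_μ` is within `ρ₂` of a fixed caustic translate have measure
  `≤ 3·6√(δ/c)`, `c = 4h_min - (4s_max² + 4A₂)(2 s_max W + ρ₂)` (`klsc_second_deriv_lower_bound` +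
  `klsc_volume_sublevel_le_of_convex_sqrt` on the three windows of the period).

The final caustic-regime inequality (good part `≤ 3N·2δ/Λ`, bad part `≤ 12·6√(δ/c)`) is assembled
from these in the next file of the seat.
-/

noncomputable section

-- the tree's namespace `Summit.<Summit>.<Problem>.Theorems` repeats the summit name by design (D-0017)
set_option linter.dupNamespace false

open Real Set MeasureTheory
open scoped ENNReal
open Literature.MathematicalPhysics.QuantumLattice
open Literature.MathematicalPhysics.QuantumLattice.BandSectorCounting

namespace Summit.HubbardSuperconductivity.HubbardSuperconductivity.Theorems

/-! ### Local descent -/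

/-- Local descent, positive case. -/
theorem klsg_exists_zero_near_of_pos {g g' : ℝ → ℝ} (hg : ∀ t, HasDerivAt g (g' t) t)
    {δ Λ z : ℝ} (hΛ : 0 < Λ) (hgz : 0 < g z) (hgzδ : g z ≤ δ)
    (htrans : ∀ t, |t - z| ≤ δ / Λ → |g t| ≤ δ → Λ ≤ |g' t|) :
    ∃ c : ℝ, |z - c| ≤ δ / Λ ∧ g c = 0 := by
  have hcont : Continuous g := continuous_iff_continuousAt.2 fun t => (hg t).continuousAt
  by_contra H
  push Not at H
  set r := δ / Λ with hr
  have hδ : 0 < δ := hgz.trans_le hgzδ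
  have hrpos : 0 < r := div_pos hδ hΛ
  have hΛr : Λ * r = δ := by rw [hr]; field_simp
  have hball : ∀ t ∈ Icc (z - r) (z + r), |t - z| ≤ δ / Λ := fun t ht => by
    rw [abs_le]; constructor <;> linarith [ht.1, ht.2]
  -- no zero of `g` on `[z - r, z + r]`
  have hnoz : ∀ t ∈ Icc (z - r) (z + r), g t ≠ 0 := by
    intro t ht h0
    have : |z - t| ≤ r := by rw [abs_le]; constructor <;> linarith [ht.1, ht.2]
    exact H t this h0
  -- hence `g > 0` there
  have hpos : ∀ t ∈ Icc (z - r) (z + r), 0 < g t := by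
    intro t ht
    by_contra hle
    push Not at hle
    rcases le_total t z with htz | hzt
    · have hivt := intermediate_value_Icc htz hcont.continuousOn
      obtain ⟨c, hc, hc0⟩ := hivt ⟨hle, hgz.le⟩
      exact hnoz c ⟨le_trans ht.1 hc.1, by linarith [hc.2]⟩ hc0
    · have hivt := intermediate_value_Icc' hzt hcont.continuousOn
      obtain ⟨c, hc, hc0⟩ := hivt ⟨hle, hgz.le⟩
      exact hnoz c ⟨by linarith [hc.1], le_trans hc.2 ht.2⟩ hc0
  have hleft : ∃ t ∈ Icc (z - r) z, δ < g t := by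
    by_contra hA
    push Not at hA
    have hder : ∀ t ∈ Icc (z - r) z, Λ ≤ |g' t| := by
      intro t ht
      have ht' : t ∈ Icc (z - r) (z + r) := ⟨ht.1, by linarith [ht.2]⟩
      refine htrans t (hball t ht') ?_
      rw [abs_of_pos (hpos t ht')]; exact hA t ht
    have hmvt := mul_sub_le_abs_sub_of_le_abs_deriv hg (by linarith : z - r ≤ z) hΛ hder
    rw [show z - (z - r) = r by ring, hΛr] at hmvt
    have h1 := hpos (z - r) ⟨le_rfl, by linarith⟩
    have h2 := hA (z - r) ⟨le_rfl, by linarith⟩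
    have h3 : |g z - g (z - r)| < δ := by rw [abs_sub_lt_iff]; constructor <;> linarith
    linarith
  have hright : ∃ t ∈ Icc z (z + r), δ < g t := by
    by_contra hA
    push Not at hA
    have hder : ∀ t ∈ Icc z (z + r), Λ ≤ |g' t| := by
      intro t ht
      have ht' : t ∈ Icc (z - r) (z + r) := ⟨by linarith [ht.1], ht.2⟩
      refine htrans t (hball t ht') ?_
      rw [abs_of_pos (hpos t ht')]; exact hA t ht
    have hmvt := mul_sub_le_abs_sub_of_le_abs_deriv hg (by linarith : z ≤ z + r) hΛ hder
    rw [show z + r - z = r by ring, hΛr] at hmvt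
    have h1 := hpos (z + r) ⟨by linarith, le_rfl⟩
    have h2 := hA (z + r) ⟨by linarith, le_rfl⟩
    have h3 : |g (z + r) - g z| < δ := by rw [abs_sub_lt_iff]; constructor <;> linarith
    linarith
  obtain ⟨t, ht, hgt⟩ := hleft
  obtain ⟨t', ht', hgt'⟩ := hright
  have htt' : t ≤ t' := le_trans ht.2 ht'.1
  obtain ⟨c, hc, hmin⟩ := isCompact_Icc.exists_isMinOn (nonempty_Icc.2 htt') hcont.continuousOn
  have hcz : g c ≤ g z := hmin ⟨ht.2, ht'.1⟩
  have hct : c ≠ t := fun h => by rw [h] at hcz; linarith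
  have hct' : c ≠ t' := fun h => by rw [h] at hcz; linarith
  have hc1 : t < c := lt_of_le_of_ne hc.1 (Ne.symm hct)
  have hc2 : c < t' := lt_of_le_of_ne hc.2 hct'
  have hloc : IsLocalMin g c := hmin.isLocalMin (Icc_mem_nhds hc1 hc2)
  have hzero : g' c = 0 := hloc.hasDerivAt_eq_zero (hg c)
  have hcI : c ∈ Icc (z - r) (z + r) := ⟨by linarith [ht.1], by linarith [ht'.2]⟩
  have hgc : |g c| ≤ δ := by rw [abs_of_pos (hpos c hcI)]; linarith
  have := htrans c (hball c hcI) hgc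
  rw [hzero, abs_zero] at this
  linarith

/-- **Local descent.** If `|g z| ≤ δ` and `|g'| ≥ Λ > 0` at every point `t` of the closed
`δ/Λ`-ball around `z` where `|g t| ≤ δ`, then `g` has a zero within `δ/Λ` of `z`. -/
theorem klsg_exists_zero_near {g g' : ℝ → ℝ} (hg : ∀ t, HasDerivAt g (g' t) t)
    {δ Λ z : ℝ} (hΛ : 0 < Λ) (hgz : |g z| ≤ δ)
    (htrans : ∀ t, |t - z| ≤ δ / Λ → |g t| ≤ δ → Λ ≤ |g' t|) :
    ∃ c : ℝ, |z - c| ≤ δ / Λ ∧ g c = 0 := by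
  have hδ : 0 ≤ δ := (abs_nonneg _).trans hgz
  rcases lt_trichotomy (g z) 0 with hneg | h0 | hposz
  · have hng : ∀ t, HasDerivAt (fun s => -g s) (-g' t) t := fun t => (hg t).neg
    have htrans' : ∀ t, |t - z| ≤ δ / Λ → |(fun s => -g s) t| ≤ δ → Λ ≤ |(-g' t)| := by
      intro t ht h; rw [abs_neg] at h ⊢; exact htrans t ht h
    obtain ⟨c, hcz, hc⟩ := klsg_exists_zero_near_of_pos hng hΛ (by show 0 < -g z; linarith)
      (by show -g z ≤ δ; rw [abs_of_neg hneg] at hgz; linarith) htrans'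
    exact ⟨c, hcz, by simpa using hc⟩
  · exact ⟨z, by rw [sub_self, abs_zero]; exact div_nonneg hδ hΛ.le, h0⟩
  · exact klsg_exists_zero_near_of_pos hg hΛ hposz (by rw [abs_of_pos hposz] at hgz; exact hgz) htrans

section Main

variable {a b : ℝ} (B : BandBounds a b) {μ : ℝ} (hμ : μ ∈ Icc a b)
include B hμ

/-! ### Near-tangent points sit at the caustic -/

/-- **A near-tangent point is odd-aligned.** If `w` keeps torus sup-distance `≥ v` from `2πℤ²`
and the even-exclusion condition holds, then at every `t` with `|G_w(t)| ≤ η` and half-slope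
`≤ λ`, `2p_μ(t)` is within `ρ₁(η, λ) = s_max D + (A₂/4)D² + η/Dt_min`, `D = C_g(λ + 2 s_max η/Dt_min)`,
of a caustic translate `w - 2πm`. -/
theorem klsg_nearTangent_near_caustic {η lam v w₁ w₂ t : ℝ}
    (hlo : a ≤ μ - η) (hhi : μ + η ≤ b)
    (hv : ∀ m₀ m₁ : ℤ, v ≤ max |w₁ - m₀ * (2 * π)| |w₂ - m₁ * (2 * π)|)
    (hH1 : B.smax * (B.Cg * (lam + 2 * B.smax * (η / B.Dtmin))) + η / B.Dtmin < v)
    (hG : |eps2 (bandX μ t - w₁) (bandY μ t - w₂) - μ| ≤ η)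
    (hG' : |Real.sin (bandX μ t - w₁) * bandVX μ t + Real.sin (bandY μ t - w₂) * bandVY μ t| ≤ lam) :
    ∃ m₀ m₁ : ℤ, max |2 * bandX μ t - (w₁ - m₀ * (2 * π))| |2 * bandY μ t - (w₂ - m₁ * (2 * π))| ≤
      B.smax * (B.Cg * (lam + 2 * B.smax * (η / B.Dtmin))) +
        B.A2 / 4 * (B.Cg * (lam + 2 * B.smax * (η / B.Dtmin))) ^ 2 + η / B.Dtmin := by
  obtain ⟨m₀, m₁, d, hd, halt⟩ := klst_transversality_alternative B hμ hlo hhi hG hG'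
  set D := B.Cg * (lam + 2 * B.smax * (η / B.Dtmin)) with hD
  have hsd : B.smax * |d| ≤ B.smax * D := mul_le_mul_of_nonneg_left hd B.smax_pos.le
  rcases halt with ⟨hx, hy⟩ | ⟨hx, hy⟩
  · exfalso
    have := hv m₀ m₁
    have hmax := max_le hx hy
    linarith
  · refine ⟨m₀, m₁, ?_⟩
    have hd2 : d ^ 2 ≤ D ^ 2 := by
      rw [← sq_abs d]; exact pow_le_pow_left₀ (abs_nonneg d) hd 2
    have hA := B.A2_pos
    have hAd : B.A2 / 4 * d ^ 2 ≤ B.A2 / 4 * D ^ 2 := mul_le_mul_of_nonneg_left hd2 (by linarith)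
    have hLX := abs_bandX_sub_le B hμ (t + d / 2) t
    have hLY := abs_bandY_sub_le B hμ (t + d / 2) t
    rw [show t + d / 2 - t = d / 2 by ring] at hLX hLY
    have hd2' : |d / 2| = |d| / 2 := by rw [abs_div, abs_two]
    rw [hd2'] at hLX hLY
    obtain ⟨hx1, hx2⟩ := abs_le.1 hx
    obtain ⟨hy1, hy2⟩ := abs_le.1 hy
    obtain ⟨hLX1, hLX2⟩ := abs_le.1 hLX
    obtain ⟨hLY1, hLY2⟩ := abs_le.1 hLY
    refine max_le ?_ ?_ <;> (rw [abs_le]; constructor <;> nlinarith)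

/-! ### The square-root cap on a caustic window -/

/-- **The caustic window bound.** Fix a lattice vector `m` and `δ > 0`. If `ρ₂/(√2 u_min) < 2` and
`c := 4h_min - (4 s_max² + 4A₂)(2 s_max·π ρ₂/(√2 u_min) + ρ₂) > 0`, the points of a period with
`|G_w| ≤ δ` and `2p_μ` within `ρ₂` of `w - 2πm` have measure `≤ 3·6√(δ/c)` (three windows of the
period around any one such point, each `c`-strongly convex for `G_w`). -/
theorem klsg_window_volume_le {w₁ w₂ θ₀ ρ₂ δ : ℝ} (m₀ m₁ : ℤ) (hδ : 0 < δ)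
    (hσ : ρ₂ / (Real.sqrt 2 * B.umin) < 2)
    (hc : 0 < 4 * B.hmin - (4 * B.smax ^ 2 + 4 * B.A2) * (2 * B.smax * (π * (ρ₂ / (Real.sqrt 2 * B.umin))) + ρ₂)) :
    volume {z ∈ Icc θ₀ (θ₀ + 2 * π) | |eps2 (bandX μ z - w₁) (bandY μ z - w₂) - μ| ≤ δ ∧
        max |2 * bandX μ z - (w₁ - m₀ * (2 * π))| |2 * bandY μ z - (w₂ - m₁ * (2 * π))| ≤ ρ₂} ≤
      3 * ENNReal.ofReal (6 * Real.sqrt (δ /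
        (4 * B.hmin - (4 * B.smax ^ 2 + 4 * B.A2) * (2 * B.smax * (π * (ρ₂ / (Real.sqrt 2 * B.umin))) + ρ₂)))) := by
  classical
  obtain ⟨h1, h2⟩ := B.level hμ
  have hπ := Real.pi_pos
  set W := π * (ρ₂ / (Real.sqrt 2 * B.umin)) with hW
  set c := 4 * B.hmin - (4 * B.smax ^ 2 + 4 * B.A2) * (2 * B.smax * W + ρ₂) with hcdef
  set V := {z ∈ Icc θ₀ (θ₀ + 2 * π) | |eps2 (bandX μ z - w₁) (bandY μ z - w₂) - μ| ≤ δ ∧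
      max |2 * bandX μ z - (w₁ - m₀ * (2 * π))| |2 * bandY μ z - (w₂ - m₁ * (2 * π))| ≤ ρ₂} with hV
  -- the level function and its derivatives
  set G : ℝ → ℝ := fun t => eps2 (bandX μ t - w₁) (bandY μ t - w₂) - μ with hG
  set G' : ℝ → ℝ := fun t =>
    2 * (Real.sin (bandX μ t - w₁) * bandVX μ t + Real.sin (bandY μ t - w₂) * bandVY μ t) with hG'
  set G'' : ℝ → ℝ := fun t =>
    2 * (Real.cos (bandX μ t - w₁) * bandVX μ t ^ 2 + Real.sin (bandX μ t - w₁) * bandAX μ t +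
      Real.cos (bandY μ t - w₂) * bandVY μ t ^ 2 + Real.sin (bandY μ t - w₂) * bandAY μ t) with hG''
  have hGd : ∀ t, HasDerivAt G (G' t) t := fun t => (klst_hasDerivAt_transLevel h1 h2 w₁ w₂ t).sub_const μ
  have hG'd : ∀ t, HasDerivAt G' (G'' t) t := fun t => klsc_hasDerivAt_transLevelDeriv h1 h2 w₁ w₂ t
  by_cases hex : ∃ ζ, ζ ∈ V
  · obtain ⟨ζ, hζP, -, hζw⟩ := hex
    -- windows
    have hwin : ∀ k : ℤ, ∀ θ ∈ Icc (ζ + k * (2 * π) - W) (ζ + k * (2 * π) + W),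
        max |2 * bandX μ θ - (w₁ - m₀ * (2 * π))| |2 * bandY μ θ - (w₂ - m₁ * (2 * π))| ≤
          2 * B.smax * W + ρ₂ := by
      intro k θ hθ
      have hper := band_add_int_mul_two_pi h1 h2 ζ k
      have hLX := abs_bandX_sub_le B hμ θ (ζ + k * (2 * π))
      have hLY := abs_bandY_sub_le B hμ θ (ζ + k * (2 * π))
      rw [hper.1] at hLX
      rw [hper.2.1] at hLY
      have hdist : |θ - (ζ + k * (2 * π))| ≤ W := by
        rw [abs_le]; constructor <;> linarith [hθ.1, hθ.2]
      obtain ⟨hζX1, hζX2⟩ := abs_le.1 ((le_max_left _ _).trans hζw)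
      obtain ⟨hζY1, hζY2⟩ := abs_le.1 ((le_max_right _ _).trans hζw)
      obtain ⟨hLX1, hLX2⟩ := abs_le.1 (hLX.trans (mul_le_mul_of_nonneg_left hdist B.smax_pos.le))
      obtain ⟨hLY1, hLY2⟩ := abs_le.1 (hLY.trans (mul_le_mul_of_nonneg_left hdist B.smax_pos.le))
      refine max_le ?_ ?_ <;> (rw [abs_le]; constructor <;> linarith)
    have hconvk : ∀ k : ℤ, ∀ t ∈ Icc (ζ + k * (2 * π) - W) (ζ + k * (2 * π) + W), c ≤ G'' t := by
      intro k t ht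
      have hlb := klsc_second_deriv_lower_bound B hμ w₁ w₂ t m₀ m₁
      have hw := hwin k t ht
      have hc0 : 0 ≤ 4 * B.smax ^ 2 + 4 * B.A2 := by nlinarith [B.smax_pos, B.A2_pos]
      have := mul_le_mul_of_nonneg_left hw hc0
      show c ≤ 2 * (Real.cos (bandX μ t - w₁) * bandVX μ t ^ 2 + Real.sin (bandX μ t - w₁) * bandAX μ t +
        Real.cos (bandY μ t - w₂) * bandVY μ t ^ 2 + Real.sin (bandY μ t - w₂) * bandAY μ t)
      rw [hcdef]; linarith
    have hvolk : ∀ k : ℤ, volume {z ∈ Icc (ζ + k * (2 * π) - W) (ζ + k * (2 * π) + W) | |G z| ≤ δ} ≤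
        ENNReal.ofReal (6 * Real.sqrt (δ / c)) :=
      fun k => klsc_volume_sublevel_le_of_convex_sqrt hGd hG'd hc hδ (hconvk k)
    -- `V` is covered by the three windows `k = -1, 0, 1`
    have hcover : V ⊆ {z ∈ Icc (ζ + (-1 : ℤ) * (2 * π) - W) (ζ + (-1 : ℤ) * (2 * π) + W) | |G z| ≤ δ} ∪
        {z ∈ Icc (ζ + (0 : ℤ) * (2 * π) - W) (ζ + (0 : ℤ) * (2 * π) + W) | |G z| ≤ δ} ∪
        {z ∈ Icc (ζ + (1 : ℤ) * (2 * π) - W) (ζ + (1 : ℤ) * (2 * π) + W) | |G z| ≤ δ} := by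
      intro z hz
      obtain ⟨hzP, hGz, hzw⟩ := hz
      have hclose : max |bandX μ z - bandX μ ζ| |bandY μ z - bandY μ ζ| ≤ ρ₂ := by
        obtain ⟨h1a, h1b⟩ := abs_le.1 ((le_max_left _ _).trans hzw)
        obtain ⟨h2a, h2b⟩ := abs_le.1 ((le_max_right _ _).trans hzw)
        obtain ⟨h3a, h3b⟩ := abs_le.1 ((le_max_left _ _).trans hζw)
        obtain ⟨h4a, h4b⟩ := abs_le.1 ((le_max_right _ _).trans hζw)
        refine max_le ?_ ?_ <;> (rw [abs_le]; constructor <;> linarith)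
      obtain ⟨k, hk⟩ := klsd_exists_int_near_of_close B hμ hclose
      have hWlt : W < 2 * π := by rw [hW]; nlinarith [hσ, hπ]
      have hzζ : |z - ζ| ≤ 2 * π := by
        rw [abs_le]; constructor <;> linarith [hzP.1, hzP.2, hζP.1, hζP.2]
      have hkabs : |(k : ℝ)| < 2 := by
        have h3 : |(k : ℝ) * (2 * π)| ≤ |z - ζ| + W := by
          have e : (k : ℝ) * (2 * π) = (z - ζ) - (z - ζ - k * (2 * π)) := by ring
          calc |(k : ℝ) * (2 * π)| = |(z - ζ) - (z - ζ - k * (2 * π))| := by rw [← e]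
            _ ≤ |z - ζ| + |z - ζ - k * (2 * π)| := abs_sub _ _
            _ ≤ |z - ζ| + W := by linarith [hk]
        rw [abs_mul, abs_of_pos (by positivity : (0:ℝ) < 2 * π)] at h3
        have h4 : |(k : ℝ)| * (2 * π) < 2 * (2 * π) := by linarith
        exact lt_of_mul_lt_mul_right h4 (by positivity)
      have hk2 : -2 < k ∧ k < 2 := by
        rw [abs_lt] at hkabs
        exact ⟨by exact_mod_cast hkabs.1, by exact_mod_cast hkabs.2⟩
      have hzI : z ∈ Icc (ζ + k * (2 * π) - W) (ζ + k * (2 * π) + W) := by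
        rw [abs_le] at hk; constructor <;> linarith [hk.1, hk.2]
      have hGz' : |G z| ≤ δ := hGz
      rcases hk2 with ⟨hk1, hk3⟩
      interval_cases k
      · exact Or.inl (Or.inl ⟨by simpa using hzI, hGz'⟩)
      · exact Or.inl (Or.inr ⟨by simpa using hzI, hGz'⟩)
      · exact Or.inr ⟨by simpa using hzI, hGz'⟩
    calc volume V ≤ volume ({z ∈ Icc (ζ + (-1 : ℤ) * (2 * π) - W) (ζ + (-1 : ℤ) * (2 * π) + W) | |G z| ≤ δ} ∪
          {z ∈ Icc (ζ + (0 : ℤ) * (2 * π) - W) (ζ + (0 : ℤ) * (2 * π) + W) | |G z| ≤ δ} ∪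
          {z ∈ Icc (ζ + (1 : ℤ) * (2 * π) - W) (ζ + (1 : ℤ) * (2 * π) + W) | |G z| ≤ δ}) :=
          measure_mono hcover
      _ ≤ volume ({z ∈ Icc (ζ + (-1 : ℤ) * (2 * π) - W) (ζ + (-1 : ℤ) * (2 * π) + W) | |G z| ≤ δ} ∪
          {z ∈ Icc (ζ + (0 : ℤ) * (2 * π) - W) (ζ + (0 : ℤ) * (2 * π) + W) | |G z| ≤ δ}) +
          volume {z ∈ Icc (ζ + (1 : ℤ) * (2 * π) - W) (ζ + (1 : ℤ) * (2 * π) + W) | |G z| ≤ δ} :=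
          measure_union_le _ _
      _ ≤ (volume {z ∈ Icc (ζ + (-1 : ℤ) * (2 * π) - W) (ζ + (-1 : ℤ) * (2 * π) + W) | |G z| ≤ δ} +
          volume {z ∈ Icc (ζ + (0 : ℤ) * (2 * π) - W) (ζ + (0 : ℤ) * (2 * π) + W) | |G z| ≤ δ}) +
          volume {z ∈ Icc (ζ + (1 : ℤ) * (2 * π) - W) (ζ + (1 : ℤ) * (2 * π) + W) | |G z| ≤ δ} := by
          gcongr; exact measure_union_le _ _
      _ ≤ (ENNReal.ofReal (6 * Real.sqrt (δ / c)) + ENNReal.ofReal (6 * Real.sqrt (δ / c))) +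
          ENNReal.ofReal (6 * Real.sqrt (δ / c)) := by
          gcongr
          · exact hvolk (-1)
          · exact hvolk 0
          · exact hvolk 1
      _ = 3 * ENNReal.ofReal (6 * Real.sqrt (δ / c)) := by ring
  · have hV0 : V = ∅ := Set.eq_empty_iff_forall_notMem.2 fun z hz => hex ⟨z, hz⟩
    rw [hV0, measure_empty]
    exact bot_le

end Main

end Summit.HubbardSuperconductivity.HubbardSuperconductivity.Theorems

end
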